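import Summits.AtomisticToContinuum.BoseEinsteinCondensation.Theorems.BECGroundStateSOSRimSqueezeDefs
import Literature.MathematicalPhysics.QuantumManyBody.BoseGasCutoffState

/-!
# Route `BECGroundStateSOS`, crux `BoundaryTransferWeak` (stmt-AtomisticToContinuum-0827),
# line `rim-squeeze-monotone-coherence`, stub (L): the rim-layer cutoff, I (profile and norms)

Supports (does not close) stmt-AtomisticToContinuum-0827; auxiliary block of the registered stub
`stub_hardWallLimit` (L) (lead c3), companion of
`Theorems/BECGroundStateSOSBoundaryTransferWeakHardWallLimitAux.lean`, which reduced (L) to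
NEAR-MINIMISER TRANSFER across the hard wall: a `δ₀`-near-minimiser `Ψ` of the ramp Hamiltonian
`H_t = H^per + t Σ_j 1_rim(x_j)` on the torus of side `L` (large `t`) must be `L²`-close to a
Dirichlet near-minimiser of the cube of side `L/2`. This file starts the `v`-INDEPENDENT half of
that transfer: the **rim-layer cutoff**, which turns `Ψ` into a Dirichlet function of the slightly
FATTENED cube `(0, L/2 + 4h)^{3N}` at a cost controlled by the rim mass
`m(Ψ) = ∫_{cell} (Σ_j 1_rim(x_j)) |Ψ|²` alone (for a near-minimiser `m ≤ (E_t + δ)/t → 0`,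
`rimMass_le_of_rampEnergy_le`).

Construction (the Basti–Cenatiempo–Schlein cut-off state of the tree,
`DiluteBoseGasUpperBoundLocalization.lean`, in the regime where the box sits INSIDE one cell):
`F(X) = Ψ(X - 2h·𝟙) · ∏_{i,k} q(x_{ik})` with a `C¹` profile `q` (`IsCutoffProfile q (h/2) (L/2+3h) D`:
ramps `[0,h] ∪ [L/2+3h, L/2+4h]`, plateau `q = 1` on `[h, L/2+3h]` — `profile_eq_one` — support
`(0, L/2+4h)`, `|q'| ≤ D`). Shifting by `2h` puts BOTH ramps, seen from `Ψ`, inside the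
periodised rim `{L/2 ≤ y < L} + Lℤ` (`mem_rimPer_of_mem_ramp`, `half_le_of_mem_rimPer`), so every
cutoff cost will be a rim mass. Here: the pointwise facts (`ennnorm_cutoff_sq_le_indicator`:
`|F|² ≤ 1_cell |Ψ(· - 2h𝟙)|²`) and the two norm bounds

* `lintegral_cutoff_sq_le_one` — `‖F‖² ≤ 1` (torus translation invariance `lintegral_cellN_comp_add`);
* `one_sub_rimMass_le_lintegral_cutoff_sq` (anchor `stub_hardWallLimit_cutoffNorm`) —
  `1 - m ≤ ‖F‖²` (the plateau box moved back by `2h` contains the core configurations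
  `[0, L/2)^{3N}`, which carry mass `≥ 1 - m`: `one_le_lintegral_noRim_add_rimMass`).

Kinetic, potential and `L²` costs are in the sequel `…HardWallLimitCutoffEnergy.lean`. All `[folklore]`.
-/
noncomputable section

namespace Summit.AtomisticToContinuum.BoseEinsteinCondensation.RimSqueeze

open Literature.MathematicalPhysics.QuantumManyBody.BoseGas
open MeasureTheory Filter Set
open scoped ENNReal NNReal ComplexConjugate

variable {N : ℕ} {L : ℝ}

/-! ### The profile: plateau and ramps -/

/-- **Plateau of a BCS cut-off profile**: `q = 1` on `[2ℓ', L']` (only the `m = 0` term of the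
partition of unity `Σ_m q(t - L'm)² = 1` survives there, and `0 ≤ q ≤ 1`). [folklore] -/
theorem profile_eq_one {ℓ' L' D : ℝ} {q : ℝ → ℝ} (hq : IsCutoffProfile q ℓ' L' D) (hL' : 0 ≤ L')
    {t : ℝ} (ht : t ∈ Icc (2 * ℓ') L') : q t = 1 := by
  have hzero : ∀ m : ℤ, m ≠ 0 → q (t - L' * m) = 0 := by
    intro m hm
    by_contra hne
    have hmem := hq.support _ hne
    rcases lt_or_gt_of_ne hm with hneg | hpos
    · have hm1 : (m : ℝ) ≤ -1 := by exact_mod_cast (show m ≤ -1 by omega)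
      have : L' * m ≤ L' * (-1) := mul_le_mul_of_nonneg_left hm1 hL'
      linarith [hmem.2, ht.1]
    · have hm1 : (1 : ℝ) ≤ m := by exact_mod_cast (show (1 : ℤ) ≤ m by omega)
      have : L' * 1 ≤ L' * m := mul_le_mul_of_nonneg_left hm1 hL'
      linarith [hmem.1, ht.2]
  have hsum := hq.pu t
  rw [tsum_eq_single 0 (fun m hm => by rw [hzero m hm]; simp)] at hsum
  simp only [Int.cast_zero, mul_zero, sub_zero] at hsum
  have hsq : q t ^ 2 = 1 := ENNReal.ofReal_eq_one.1 hsum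
  nlinarith [hsq, (hq.range t).1, (hq.range t).2,
    mul_nonneg (hq.range t).1 (sub_nonneg.2 (hq.range t).2)]

/-- The periodised rim range `{L/2 ≤ y < L} + Lℤ` of one coordinate is `L`-periodic. [folklore] -/
theorem mem_rimPer_add_iff (L y : ℝ) :
    (y + L ∈ {y : ℝ | ∃ m : ℤ, L / 2 ≤ y - m * L ∧ y - m * L < L}) ↔
      (y ∈ {y : ℝ | ∃ m : ℤ, L / 2 ≤ y - m * L ∧ y - m * L < L}) := by
  constructor
  · rintro ⟨m, h1, h2⟩
    refine ⟨m - 1, ?_, ?_⟩ <;> push_cast <;> linarith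
  · rintro ⟨m, h1, h2⟩
    refine ⟨m + 1, ?_, ?_⟩ <;> push_cast <;> linarith

/-- On the fundamental period `[0, L)` the periodised rim range is the rim range `[L/2, L)`.
[folklore] -/
theorem half_le_of_mem_rimPer {L y : ℝ} (hy : y ∈ Ico 0 L)
    (h : y ∈ {y : ℝ | ∃ m : ℤ, L / 2 ≤ y - m * L ∧ y - m * L < L}) : L / 2 ≤ y := by
  obtain ⟨m, h1, h2⟩ := h
  have hL : 0 < L := hy.1.trans_lt hy.2
  have hm0 : m ≤ 0 := by
    by_contra hm
    have hm1 : (1 : ℝ) ≤ m := by exact_mod_cast (show (1 : ℤ) ≤ m by omega)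
    have : 1 * L ≤ m * L := mul_le_mul_of_nonneg_right hm1 hL.le
    linarith [hy.2]
  have hm0' : 0 ≤ m := by
    by_contra hm
    have hm1 : (m : ℝ) ≤ -1 := by exact_mod_cast (show m ≤ -1 by omega)
    have : m * L ≤ (-1) * L := mul_le_mul_of_nonneg_right hm1 hL.le
    linarith [hy.1]
  obtain rfl : m = 0 := le_antisymm hm0 hm0'
  simpa using h1

/-- **The shifted ramps sit in the rim**: with ramps `[0, h] ∪ [L/2+3h, L/2+4h]` (the BCS profile
with `ℓ' = h/2`, `L' = L/2 + 3h`) and `8h < L`, every ramp point moved back by `2h` lies in the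
periodised rim range. [folklore] -/
theorem mem_rimPer_of_mem_ramp {L h y : ℝ} (hh : 0 < h) (h8 : 8 * h < L)
    (hy : y ∈ Icc 0 (2 * (h / 2)) ∪ Icc (L / 2 + 3 * h) (L / 2 + 3 * h + 2 * (h / 2))) :
    y - 2 * h ∈ {y : ℝ | ∃ m : ℤ, L / 2 ≤ y - m * L ∧ y - m * L < L} := by
  rcases hy with ⟨h1, h2⟩ | ⟨h1, h2⟩
  · refine ⟨-1, ?_, ?_⟩ <;> push_cast <;> linarith
  · refine ⟨0, ?_, ?_⟩ <;> push_cast <;> linarith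

/-! ### Pointwise facts about the product cut-off `Q(X) = ∏_{i,k} q(x_{ik})` -/

section Pointwise

variable {q : ℝ → ℝ}

/-- `0 ≤ Q`. [folklore] -/
theorem prodCutoff_nonneg (hq01 : ∀ t, 0 ≤ q t ∧ q t ≤ 1) (X : Config N) :
    0 ≤ ∏ p : Fin N × Fin 3, q (X p.1 p.2) :=
  Finset.prod_nonneg fun _ _ => (hq01 _).1

/-- `Q ≤ 1`. [folklore] -/
theorem prodCutoff_le_one (hq01 : ∀ t, 0 ≤ q t ∧ q t ≤ 1) (X : Config N) :
    ∏ p : Fin N × Fin 3, q (X p.1 p.2) ≤ 1 :=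
  Finset.prod_le_one (fun _ _ => (hq01 _).1) fun _ _ => (hq01 _).2

/-- Where `Q ≠ 0` every coordinate is in the support window `(0, S)`, hence (for `S ≤ L`) the
configuration is in the cell `[0, L)^{3N}`. [folklore] -/
theorem mem_cellN_of_prodCutoff_ne_zero {S : ℝ} (hsupp : ∀ t, q t ≠ 0 → t ∈ Ioo 0 S)
    (hS : S ≤ L) {X : Config N} (hX : ∏ p : Fin N × Fin 3, q (X p.1 p.2) ≠ 0) : X ∈ cellN N L := by
  intro i k
  have ht := hsupp _ (Finset.prod_ne_zero_iff.1 hX (i, k) (Finset.mem_univ _))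
  exact ⟨ht.1.le, ht.2.trans_le hS⟩

/-- Where `Q ≠ 0` every coordinate is in `(0, S)`: the configuration is in the open box of side
`S`. [folklore] -/
theorem mem_boxN_of_prodCutoff_ne_zero {S : ℝ} (hsupp : ∀ t, q t ≠ 0 → t ∈ Ioo 0 S)
    {X : Config N} (hX : ∏ p : Fin N × Fin 3, q (X p.1 p.2) ≠ 0) : X ∈ boxN N S :=
  fun i k => hsupp _ (Finset.prod_ne_zero_iff.1 hX (i, k) (Finset.mem_univ _))

/-- On the plateau box `Q = 1`. [folklore] -/
theorem prodCutoff_eq_one {a b : ℝ} (hplat : ∀ t, t ∈ Icc a b → q t = 1) {X : Config N}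
    (hX : ∀ i k, X i k ∈ Icc a b) : ∏ p : Fin N × Fin 3, q (X p.1 p.2) = 1 :=
  Finset.prod_eq_one fun p _ => hplat _ (hX p.1 p.2)

/-- **The cut-off function is dominated by the cell cut-off of the shifted state**:
`|Ψ(X+U) Q(X)|² ≤ 1_{cell^N}(X) |Ψ(X+U)|²` (`Q ≤ 1`, and `Q ≠ 0` forces `X` into the cell).
[folklore] -/
theorem ennnorm_cutoff_sq_le_indicator (hq01 : ∀ t, 0 ≤ q t ∧ q t ≤ 1) {S : ℝ}
    (hsupp : ∀ t, q t ≠ 0 → t ∈ Ioo 0 S) (hS : S ≤ L) (ψ : Config N → ℂ) (U X : Config N) :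
    (‖ψ (X + U) * ((∏ p : Fin N × Fin 3, q (X p.1 p.2) : ℝ) : ℂ)‖₊ : ℝ≥0∞) ^ 2 ≤
      (cellN N L).indicator (fun X => (‖ψ (X + U)‖₊ : ℝ≥0∞) ^ 2) X := by
  by_cases hX : (∏ p : Fin N × Fin 3, q (X p.1 p.2)) = 0
  · simp [hX]
  · rw [indicator_of_mem (mem_cellN_of_prodCutoff_ne_zero hsupp hS hX), mul_comm,
      ennorm_real_mul_sq _ (prodCutoff_nonneg hq01 X)]
    calc _ ≤ ENNReal.ofReal 1 * (‖ψ (X + U)‖₊ : ℝ≥0∞) ^ 2 := by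
          gcongr
          exact pow_le_one₀ (prodCutoff_nonneg hq01 X) (prodCutoff_le_one hq01 X)
      _ = _ := by rw [ENNReal.ofReal_one, one_mul]

/-- `ofReal (Q²) ≤ 1_{cell^N}` pointwise. [folklore] -/
theorem ofReal_prodCutoff_sq_le_indicator (hq01 : ∀ t, 0 ≤ q t ∧ q t ≤ 1) {S : ℝ}
    (hsupp : ∀ t, q t ≠ 0 → t ∈ Ioo 0 S) (hS : S ≤ L) (X : Config N) :
    ENNReal.ofReal ((∏ p : Fin N × Fin 3, q (X p.1 p.2)) ^ 2) ≤
      (cellN N L).indicator (1 : Config N → ℝ≥0∞) X := by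
  by_cases hX : (∏ p : Fin N × Fin 3, q (X p.1 p.2)) = 0
  · simp [hX]
  · rw [indicator_of_mem (mem_cellN_of_prodCutoff_ne_zero hsupp hS hX), Pi.one_apply,
      ← ENNReal.ofReal_one]
    exact ENNReal.ofReal_le_ofReal
      (pow_le_one₀ (prodCutoff_nonneg hq01 X) (prodCutoff_le_one hq01 X))

/-- Coordinates of a generator shift: `(Y + L e_{i',k'})_{ik} = Y_{ik} + L δ_{ii'} δ_{kk'}`.
[folklore] -/
theorem add_single_apply_apply (Y : Config N) (i i' : Fin N) (k k' : Fin 3) (L : ℝ) :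
    (Y + Pi.single i' (EuclideanSpace.single k' L) : Config N) i k =
      Y i k + if i = i' ∧ k = k' then L else 0 := by
  rw [Pi.add_apply]
  by_cases hi : i = i'
  · subst hi
    rw [Pi.single_eq_same, WithLp.ofLp_add, Pi.add_apply, euclideanSpace_single_apply]
    by_cases hk : k = k' <;> simp [hk]
  · rw [Pi.single_eq_of_ne hi, add_zero]
    simp [hi]

end Pointwise

/-! ### Integral bounds for the cut-off of a periodic trial state -/

section Integrals

variable {h D : ℝ} {q : ℝ → ℝ}

/-- The translation moving everything back by `2h` along every axis of every particle. [folklore] -/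
theorem shift_apply (h : ℝ) (X : Config N) (i : Fin N) (k : Fin 3) :
    (X + fun _ => (WithLp.toLp 2 fun _ : Fin 3 => -(2 * h) : Space) : Config N) i k = X i k - 2 * h := by
  rw [Pi.add_apply, WithLp.ofLp_add, Pi.add_apply]
  show X i k + (-(2 * h)) = X i k - 2 * h
  ring

/-- **`‖F‖² ≤ 1`**: `∫ |Ψ(X+U) Q(X)|² ≤ ∫_{cell} |Ψ(· + U)|² = ∫_{cell} |Ψ|² = 1` (torus translation
invariance of the cell integral). [folklore] -/
theorem lintegral_cutoff_sq_le_one (hL : 0 < L) (h8 : 8 * h < L)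
    (hq : IsCutoffProfile q (h / 2) (L / 2 + 3 * h) D) (Ψ : PeriodicTrialState N L) (u : Space) :
    ∫⁻ X, (‖Ψ.ψ (X + fun _ => u) * ((∏ p : Fin N × Fin 3, q (X p.1 p.2) : ℝ) : ℂ)‖₊ : ℝ≥0∞) ^ 2 ≤ 1 := by
  have hS : L / 2 + 3 * h + 2 * (h / 2) ≤ L := by linarith
  calc _ ≤ ∫⁻ X, (cellN N L).indicator (fun X => (‖Ψ.ψ (X + fun _ => u)‖₊ : ℝ≥0∞) ^ 2) X :=
        lintegral_mono fun X => ennnorm_cutoff_sq_le_indicator hq.range hq.support hS _ _ X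
    _ = ∫⁻ X in cellN N L, (‖Ψ.ψ (X + fun _ => u)‖₊ : ℝ≥0∞) ^ 2 :=
        lintegral_indicator (measurableSet_cellN N L) _
    _ = 1 := by
        rw [lintegral_cellN_comp_add hL (G := fun X => (‖Ψ.ψ X‖₊ : ℝ≥0∞) ^ 2)
          (fun X i k => by rw [Ψ.periodic])]
        exact Ψ.norm_eq

/-- The core configurations (no particle in the rim) are measurable. [folklore] -/
theorem measurableSet_noRim (N : ℕ) (L : ℝ) : MeasurableSet {Y : Config N | ∀ i k, Y i k < L / 2} := by
  have : {Y : Config N | ∀ i k, Y i k < L / 2} =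
      ⋂ i : Fin N, ⋂ k : Fin 3, (fun Y : Config N => Y i k) ⁻¹' Iio (L / 2) := by
    ext Y; simp
  rw [this]
  exact MeasurableSet.iInter fun i => MeasurableSet.iInter fun k =>
    measurableSet_Iio.preimage (by fun_prop)

/-- **The mass outside the rim is at least `1 - m`**: `1 ≤ ∫_{cell ∩ {no particle in the rim}} |Ψ|² + m`,
`m = ∫_{cell} (Σ_j 1_rim(x_j)) |Ψ|²`. [folklore] -/
theorem one_le_lintegral_noRim_add_rimMass (Ψ : PeriodicTrialState N L) :
    1 ≤ (∫⁻ Y in cellN N L, {Y : Config N | ∀ i k, Y i k < L / 2}.indicator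
        (fun Y => (‖Ψ.ψ Y‖₊ : ℝ≥0∞) ^ 2) Y) +
      ∫⁻ Y in cellN N L, (∑ j, rimPot L (Y j)) * (‖Ψ.ψ Y‖₊ : ℝ≥0∞) ^ 2 := by
  have hmeas : Measurable fun Y => {Y : Config N | ∀ i k, Y i k < L / 2}.indicator
      (fun Y => (‖Ψ.ψ Y‖₊ : ℝ≥0∞) ^ 2) Y :=
    (measurable_normSq Ψ.contDiff.continuous).indicator (measurableSet_noRim N L)
  rw [← Ψ.norm_eq, ← lintegral_add_left hmeas]
  refine lintegral_mono fun Y => ?_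
  by_cases hY : Y ∈ {Y : Config N | ∀ i k, Y i k < L / 2}
  · rw [indicator_of_mem hY]
    exact le_self_add
  · rw [indicator_of_notMem hY, zero_add]
    simp only [mem_setOf_eq, not_forall, not_lt] at hY
    obtain ⟨i, k, hik⟩ := hY
    have h1 : (1 : ℝ≥0∞) ≤ ∑ j, rimPot L (Y j) := by
      calc (1 : ℝ≥0∞) = rimPot L (Y i) := by rw [rimPot_apply, if_pos ⟨k, hik⟩]
        _ ≤ ∑ j, rimPot L (Y j) :=
          Finset.single_le_sum (f := fun j => rimPot L (Y j)) (fun j _ => zero_le)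
            (Finset.mem_univ i)
    calc (‖Ψ.ψ Y‖₊ : ℝ≥0∞) ^ 2 = 1 * (‖Ψ.ψ Y‖₊ : ℝ≥0∞) ^ 2 := (one_mul _).symm
      _ ≤ _ := by gcongr

/-- **`1 - m ≤ ‖F‖²`**: on the plateau box `[h, L/2+3h]^{3N}` the cut-off is `Ψ(· - 2h𝟙)` itself,
and that box moved back by `2h` contains the core configurations `[0, L/2)^{3N}` of the cell, which
carry mass `≥ 1 - m`. [folklore] -/
theorem one_sub_rimMass_le_lintegral_cutoff_sq (hh : 0 < h) (h8 : 8 * h < L)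
    (hq : IsCutoffProfile q (h / 2) (L / 2 + 3 * h) D) (Ψ : PeriodicTrialState N L) :
    1 - ∫⁻ Y in cellN N L, (∑ j, rimPot L (Y j)) * (‖Ψ.ψ Y‖₊ : ℝ≥0∞) ^ 2 ≤
      ∫⁻ X, (‖Ψ.ψ (X + fun _ => (WithLp.toLp 2 fun _ : Fin 3 => -(2 * h) : Space)) *
        ((∏ p : Fin N × Fin 3, q (X p.1 p.2) : ℝ) : ℂ)‖₊ : ℝ≥0∞) ^ 2 := by
  classical
  set U : Config N := fun _ => (WithLp.toLp 2 fun _ : Fin 3 => -(2 * h) : Space) with hU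
  set P : Set (Config N) := {X | ∀ i k, X i k ∈ Icc h (L / 2 + 3 * h)} with hP
  set C : Set (Config N) := {Y | ∀ i k, Y i k < L / 2} with hC
  have hplat : ∀ t, t ∈ Icc (2 * (h / 2)) (L / 2 + 3 * h) → q t = 1 := fun t ht =>
    profile_eq_one hq (by linarith) ht
  refine tsub_le_iff_right.2 ((one_le_lintegral_noRim_add_rimMass Ψ).trans (add_le_add ?_ le_rfl))
  -- `∫_{cell ∩ C} |Ψ|² ≤ ∫ 1_P(Y - U) |Ψ(Y)|² = ∫ 1_P(X) |Ψ(X + U)|² ≤ ∫ |F|²`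
  have hstep1 : (∫⁻ Y in cellN N L, C.indicator (fun Y => (‖Ψ.ψ Y‖₊ : ℝ≥0∞) ^ 2) Y) ≤
      ∫⁻ Y, P.indicator (1 : Config N → ℝ≥0∞) (Y - U) * (‖Ψ.ψ Y‖₊ : ℝ≥0∞) ^ 2 := by
    rw [← lintegral_indicator (measurableSet_cellN N L)]
    refine lintegral_mono fun Y => ?_
    by_cases hY : Y ∈ cellN N L ∧ Y ∈ C
    · have hYP : Y - U ∈ P := by
        intro i k
        have e : (Y - U) i k = Y i k + 2 * h := by
          rw [Pi.sub_apply, WithLp.ofLp_sub, Pi.sub_apply]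
          show Y i k - (-(2 * h)) = Y i k + 2 * h
          ring
        rw [e]
        have h1 := (hY.1 i k).1
        have h2 := hY.2 i k
        constructor <;> linarith
      rw [indicator_of_mem hY.1, indicator_of_mem hY.2, indicator_of_mem hYP, Pi.one_apply, one_mul]
    · have : (cellN N L).indicator (C.indicator fun Y => (‖Ψ.ψ Y‖₊ : ℝ≥0∞) ^ 2) Y = 0 := by
        rw [not_and_or] at hY
        rcases hY with hY | hY
        · exact indicator_of_notMem hY _
        · rw [indicator_apply]
          split_ifs
          · exact indicator_of_notMem hY _
          · rfl
      rw [this]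
      exact zero_le
  have hstep2 : (∫⁻ Y, P.indicator (1 : Config N → ℝ≥0∞) (Y - U) * (‖Ψ.ψ Y‖₊ : ℝ≥0∞) ^ 2) =
      ∫⁻ X, P.indicator (1 : Config N → ℝ≥0∞) X * (‖Ψ.ψ (X + U)‖₊ : ℝ≥0∞) ^ 2 := by
    rw [← lintegral_add_right_eq_self
      (fun Y => P.indicator (1 : Config N → ℝ≥0∞) (Y - U) * (‖Ψ.ψ Y‖₊ : ℝ≥0∞) ^ 2) U]
    simp only [add_sub_cancel_right]
  refine hstep1.trans (hstep2.le.trans (lintegral_mono fun X => ?_))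
  by_cases hX : X ∈ P
  · rw [indicator_of_mem hX, Pi.one_apply, one_mul, prodCutoff_eq_one hplat (fun i k => ?_)]
    · simp
    · have := hX i k
      rwa [show 2 * (h / 2) = h by ring]
  · rw [indicator_of_notMem hX, zero_mul]
    exact zero_le

/-- **Anchor of this block (`1 - m ≤ ‖F‖²`, quantified form of
`one_sub_rimMass_le_lintegral_cutoff_sq`).** [folklore] -/
theorem stub_hardWallLimit_cutoffNorm : ∀ {N : ℕ} {L h D : ℝ} {q : ℝ → ℝ}, 0 < h → 8 * h < L → IsCutoffProfile q (h / 2) (L / 2 + 3 * h) D → ∀ Ψ : PeriodicTrialState N L, 1 - ∫⁻ Y in cellN N L, (∑ j, rimPot L (Y j)) * (‖Ψ.ψ Y‖₊ : ℝ≥0∞) ^ 2 ≤ ∫⁻ X : Config N, (‖Ψ.ψ (X + fun _ => (WithLp.toLp 2 fun _ : Fin 3 => -(2 * h) : Space)) * ((∏ p : Fin N × Fin 3, q (X p.1 p.2) : ℝ) : ℂ)‖₊ : ℝ≥0∞) ^ 2 :=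
  fun hh h8 hq Ψ => one_sub_rimMass_le_lintegral_cutoff_sq hh h8 hq Ψ

end Integrals

end Summit.AtomisticToContinuum.BoseEinsteinCondensation.RimSqueeze

end
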